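import Summits.HodgeConjecture.CorCM.GaloisDicyclicNondegenerate
import Summits.HodgeConjecture.CorCM.GaloisDicyclicReduction
import Mathlib.FieldTheory.Galois.Basic
import HarnessLib

/-!
# The proper CM subfield `K^{C_q}` of a dicyclic Galois CM field: Galois, with generalised quaternion group
# `Q_{2^{k+2}} = Dic_{2^k}`

COR-CM (cell `pub-hodgecm2`), binder seat b04 (gen 21), count-neutral claim DICYCLIC-ALLTYPES, part II — step P2 of
the ALL-TYPES programme (`A7-JUNCTION.md`, gen 20): for a Galois CM field `K` with `Gal(K/ℚ) ≅ Dic_n`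
(Mathlib `QuaternionGroup n`), `n = 2^k q` with `q` odd, the kernel `H` of the composite
`Gal(K/ℚ) ≃ Dic_n → Dic_{2^k}` (gen 20 part XIV `exists_reductionHom`, `t = q` odd) is the subgroup `e⁻¹⟨a^{2^{k+1}}⟩`
(of order `q`), complex conjugation `c = e⁻¹(aⁿ)` is NOT in `H`, and the fixed field `K₀ = K^H` is Galois over `ℚ`
of degree `2^{k+2}` with `Gal(K₀/ℚ) ≅ Dic_{2^k} = Q_{2^{k+2}}` (Mathlib `IsGalois.normalAutEquivQuotient` and
`QuotientGroup.quotientKerEquivOfSurjective`).  By part IV (`isNondegenerate_quaternion`) EVERY CM type of such a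
`K₀` is nondegenerate; part III consumes this.  KERNEL ONLY: theorems; no definition, no named fact, no `sorry`.
`HC_CM` is neither used nor claimed.

* §1 `exists_reductionHom_kernel` — the reduction `f : Dic_n →* Dic_{2^k}` with `f` onto, `f(aⁿ) = a^{2^k} ≠ 1`,
  and `f g = 1 ↔ g ∈ ⟨a^{2^{k+1}}⟩`.
* §2 **`exists_kernel_subgroup_quaternion`** — the normal subgroup `H ≤ Gal(K/ℚ)` with
  `u ∈ H ↔ e u ∈ ⟨a^{2^{k+1}}⟩`, `c ∉ H`, `K^H/ℚ` Galois with `Gal(K^H/ℚ) ≃* QuaternionGroup (2^k)`, `|H| = q`,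
  `[K^H : ℚ] = 2^{k+2}`.

## References

* [Dodson1984] B. Dodson, *The structure of Galois groups of CM-fields*, Trans. AMS 283 (1984), §2 (imprimitivity
  sequences), §5 (group tables).
* [Shimura1998] G. Shimura, *Abelian Varieties with Complex Multiplication and Modular Functions*, §8.2.
-/

noncomputable section

open NumberField

namespace Summit.HodgeConjecture.CorCM.GaloisDicyclic

open QuaternionGroup

/-! ## §1 The reduction `Dic_n → Dic_{2^k}` and its kernel `⟨a^{2^{k+1}}⟩` -/

section Group

variable {n : ℕ} [NeZero n]

/-- `a^{2^k} ≠ 1` in `Dic_{2^k}` (`2^k ≢ 0 (mod 2^{k+1})`). [folklore] -/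
theorem a_two_pow_ne_one (k : ℕ) : (a ((2 ^ k : ℕ) : ZMod (2 * 2 ^ k)) : QuaternionGroup (2 ^ k)) ≠ 1 := by
  rw [one_def, Ne, a.injEq, ZMod.natCast_eq_zero_iff]
  intro h
  have h1 := Nat.le_of_dvd (by positivity) h
  have h2 : 0 < 2 ^ k := by positivity
  omega

/-- **The reduction homomorphism `Dic_n → Dic_{2^k}`** (`n = 2^k q`, `q` odd): onto, the central involution `aⁿ`
goes to the central involution `a^{2^k} ≠ 1`, and the kernel is the cyclic group `⟨a^{2^{k+1}}⟩` (gen 20 part XIV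
with `m = 2^k`, `t = q`). [cite: Dodson1984, §2] -/
theorem exists_reductionHom_kernel {k q : ℕ} (hn : n = 2 ^ k * q) (hq : Odd q) :
    ∃ f : QuaternionGroup n →* QuaternionGroup (2 ^ k),
      Function.Surjective f ∧ f (a n) = a (2 ^ k : ℕ) ∧ f (a n) ≠ 1 ∧
      ∀ g : QuaternionGroup n, f g = 1 ↔ g ∈ Subgroup.zpowers (a ((2 ^ (k + 1) : ℕ) : ZMod (2 * n))) := by
  obtain ⟨f, hfa, hfx⟩ := exists_reductionHom (m := 2 ^ k) (t := q) hn hq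
  have han : f (a n) = a (2 ^ k : ℕ) := by
    rw [reductionHom_a_n hn hq hfa]
  refine ⟨f, reductionHom_surjective hn hfa hfx, han, by rw [han]; exact a_two_pow_ne_one k, fun g => ?_⟩
  rw [reductionHom_eq_one_iff hn hfa hfx g, show (2 * 2 ^ k : ℕ) = 2 ^ (k + 1) by rw [pow_succ']]
  constructor
  · rintro ⟨s, rfl⟩
    exact Subgroup.npow_mem_zpowers _ s
  · intro hg
    rw [← mem_powers_iff_mem_zpowers] at hg
    obtain ⟨s, hs⟩ := hg
    exact ⟨s, hs.symm⟩

end Group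

/-! ## §2 The fixed field `K^{C_q}` -/

section Field

variable {n : ℕ} [NeZero n]
variable {K : Type} [Field K] [NumberField K] [IsCMField K] [IsGalois ℚ K]

/-- **The subgroup `C_q` and its fixed field.**  For `Gal(K/ℚ) ≅ Dic_n`, `n = 2^k q` with `q` odd: the kernel `H` of
`Gal(K/ℚ) → Dic_{2^k}` is normal, `u ∈ H ↔ e u ∈ ⟨a^{2^{k+1}}⟩`, complex conjugation is not in `H`, and the fixed
field `K^H` has Galois group `Gal(K^H/ℚ) ≅ Dic_{2^k} = Q_{2^{k+2}}`, with `|H| = q` and `[K^H : ℚ] = 2^{k+2}`.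
[cite: Dodson1984, §2] [cite: Shimura1998, §8.2] -/
theorem exists_kernel_subgroup_quaternion {k q : ℕ} (hn : n = 2 ^ k * q) (hq : Odd q)
    (e : (K ≃ₐ[ℚ] K) ≃* QuaternionGroup n) :
    ∃ (H : Subgroup (K ≃ₐ[ℚ] K)) (_ : H.Normal),
      (∀ u : K ≃ₐ[ℚ] K, u ∈ H ↔ e u ∈ Subgroup.zpowers (a ((2 ^ (k + 1) : ℕ) : ZMod (2 * n)))) ∧
      (IsCMField.complexConj K).restrictScalars ℚ ∉ H ∧ IsGalois ℚ (IntermediateField.fixedField H) ∧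
      Nonempty (((IntermediateField.fixedField H) ≃ₐ[ℚ] (IntermediateField.fixedField H)) ≃*
        QuaternionGroup (2 ^ k)) ∧
      Nat.card H = q ∧ Module.finrank ℚ (IntermediateField.fixedField H) = 2 ^ (k + 2) := by
  obtain ⟨f, hfs, hfan, hfan1, hker⟩ := exists_reductionHom_kernel hn hq
  set φ : (K ≃ₐ[ℚ] K) →* QuaternionGroup (2 ^ k) := f.comp e.toMonoidHom with hφ_def
  have hφ : ∀ u, φ u = f (e u) := fun u => rfl
  have hφs : Function.Surjective φ := hfs.comp e.surjective
  set H : Subgroup (K ≃ₐ[ℚ] K) := φ.ker with hH_def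
  haveI hHn : H.Normal := MonoidHom.normal_ker φ
  have hG : IsGalois ℚ (IntermediateField.fixedField H) := IsGalois.of_fixedField_normal_subgroup H
  have hmem : ∀ u : K ≃ₐ[ℚ] K, u ∈ H ↔ e u ∈ Subgroup.zpowers (a ((2 ^ (k + 1) : ℕ) : ZMod (2 * n))) :=
    fun u => by rw [hH_def, MonoidHom.mem_ker, hφ, hker]
  have hc : (IsCMField.complexConj K).restrictScalars ℚ ∉ H := by
    rw [hH_def, MonoidHom.mem_ker, hφ, map_complexConj_eq_a e]
    exact hfan1
  -- `Gal(K^H/ℚ) ≃ Gal(K/ℚ)/H ≃ Dic_{2^k}`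
  let e₀ : ((IntermediateField.fixedField H) ≃ₐ[ℚ] (IntermediateField.fixedField H)) ≃* QuaternionGroup (2 ^ k) :=
    (IsGalois.normalAutEquivQuotient H).symm.trans (QuotientGroup.quotientKerEquivOfSurjective φ hφs)
  -- `|H| = q`
  have hcardG : Nat.card (K ≃ₐ[ℚ] K) = 4 * n := by
    rw [Nat.card_congr e.toEquiv, Nat.card_eq_fintype_card, QuaternionGroup.card]
  have hcardK : Module.finrank ℚ K = 4 * n := by rw [← IsGalois.card_aut_eq_finrank, hcardG]
  have hcardQ : Nat.card ((K ≃ₐ[ℚ] K) ⧸ H) = 4 * 2 ^ k := by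
    rw [Nat.card_congr (QuotientGroup.quotientKerEquivOfSurjective φ hφs).toEquiv, Nat.card_eq_fintype_card,
      QuaternionGroup.card]
  have hcardH : Nat.card H = q := by
    have h := Subgroup.card_eq_card_quotient_mul_card_subgroup H
    rw [hcardG, hcardQ, hn] at h
    have h4 : 0 < 4 * 2 ^ k := by positivity
    exact (Nat.eq_of_mul_eq_mul_left h4 (by linarith)).symm
  have hdeg : Module.finrank ℚ (IntermediateField.fixedField H) = 2 ^ (k + 2) := by
    have h1 := Module.finrank_mul_finrank ℚ (IntermediateField.fixedField H) K
    rw [IntermediateField.finrank_fixedField_eq_card, hcardH, hcardK, hn] at h1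
    have hqpos : 0 < q := hq.pos
    have h2 : Module.finrank ℚ (IntermediateField.fixedField H) * q = (4 * 2 ^ k) * q := by rw [h1]; ring
    rw [Nat.eq_of_mul_eq_mul_right hqpos h2, pow_add]
    ring
  exact ⟨H, hHn, hmem, hc, hG, ⟨e₀⟩, hcardH, hdeg⟩

end Field

end Summit.HodgeConjecture.CorCM.GaloisDicyclic

end
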